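import Summits.Ventures.PercRepro.Night2LocalD3TwoTwoB
import Summits.Ventures.PercRepro.Night2LocalD3ThreeTwoPre

/-!
# PercRepro — the cell `(a, k) = (3, 1)` at `|E ∖ G| = 3`, `q = 4`: structure (night-2, gen 13)

`M|G` has ONE coloop `K = {y}`; at a far set `S` with three coloops, `coloops S = K ∪ {x₁, x₂}` (`exists_coloops_eq_insert_insert`),
`|S| = 6` and the non-coloops `T` form a three-point line; the members carrying weight are the candidates `cand r = insert r (coloops S)`
(`r ∈ T`, `Night2LocalD3ThreeTwoC`).  The two deletions `S ∖ x₁`, `S ∖ x₂` are the layer-1 preimages of `S`.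

* the rank lemma `mem_clF_pair_of_mem_clF_coloops`: a point of `G ∖ K` in `cl(K ∪ {x₁, x₂})` lies in `cl {x₁, x₂}`;
* **two fat candidates kill the preimages of `S`** (`not_erase_mem_Uq_of_two_fat`): `G ∖ S ⊆ cl(cand r) ∩ cl(cand r') = cl(coloops S)`,
  hence `⊆ cl {x₁, x₂}`, and `E ∖ (S ∖ xⱼ) ⊆ cl {x₁, x₂} ∪ (E ∖ G)` has rank `≤ 5`;
* `L₁(S) ≤ r₁' + r₂'` (`L1_le_req_erase_two`) and `L₁(S ∖ v) ≤ r₁' + r₂' + r_u + r_{u'}` (`L1_erase_le_four`), with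
  `rⱼ' = [S ∖ xⱼ member] · req(S ∖ xⱼ)` and `r_u = [cand u member] · req(cand u)`.
-/

open scoped Matroid

namespace PercRepro.Shadow

open Finset PerFlat ThmH

variable {α : Type*} [DecidableEq α] {M : Matroid α} [M.Finite]

section ThreeOneA

variable {G S : Finset α}

open scoped Classical in
/-- With one coloop of `M|G` and three coloops of `S`, `coloops S = K ∪ {x₁, x₂}` with `x₁ ≠ x₂` outside `K`. -/
theorem exists_coloops_eq_insert_insert (hS : S ∈ shadowAt M (4 + 2) 4 (Uq M (4 + 2) 4) G) (hk : kColoops M G = 1)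
    (ha : (coloops M S).card = 3) :
    ∃ x₁ x₂, x₁ ≠ x₂ ∧ x₁ ∉ G.filter (fun y => y ∉ clF M (G.erase y)) ∧ x₂ ∉ G.filter (fun y => y ∉ clF M (G.erase y)) ∧
      coloops M S = insert x₁ (insert x₂ (G.filter (fun y => y ∉ clF M (G.erase y)))) := by
  set K := G.filter (fun y => y ∉ clF M (G.erase y)) with hKdef
  have hKsub : K ⊆ coloops M S := coloopsG_subset_coloops hS
  have hKc : K.card = 1 := by unfold kColoops at hk; rw [← hKdef] at hk; exact hk
  have hdiff : (coloops M S \ K).card = 2 := by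
    have := Finset.card_sdiff_add_card_eq_card hKsub
    omega
  obtain ⟨x₁, x₂, hne, hx⟩ := Finset.card_eq_two.1 hdiff
  have hx₁ : x₁ ∈ coloops M S \ K := by rw [hx]; exact Finset.mem_insert_self _ _
  have hx₂ : x₂ ∈ coloops M S \ K := by rw [hx]; exact Finset.mem_insert_of_mem (Finset.mem_singleton_self _)
  refine ⟨x₁, x₂, hne, (Finset.mem_sdiff.1 hx₁).2, (Finset.mem_sdiff.1 hx₂).2, ?_⟩
  ext e
  simp only [Finset.mem_insert]
  constructor
  · intro he
    by_cases heK : e ∈ K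
    · exact Or.inr (Or.inr heK)
    · have : e ∈ coloops M S \ K := Finset.mem_sdiff.2 ⟨he, heK⟩
      rw [hx, Finset.mem_insert, Finset.mem_singleton] at this
      rcases this with h | h
      · exact Or.inl h
      · exact Or.inr (Or.inl h)
  · rintro (rfl | rfl | heK)
    · exact (Finset.mem_sdiff.1 hx₁).1
    · exact (Finset.mem_sdiff.1 hx₂).1
    · exact hKsub heK

/-- **Rank lemma at one coloop**: a point `p ∈ G ∖ K` in `cl(K ∪ {x₁, x₂})` (`x₁, x₂ ∈ G ∖ K`) lies in `cl {x₁, x₂}`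
(`ρ(K ∪ X) = |K| + ρ(X)`). -/
theorem mem_clF_pair_of_mem_clF_coloops (hG : G ∈ flatsQ M (4 + 1)) {x₁ x₂ p : α} (hx₁G : x₁ ∈ G) (hx₂G : x₂ ∈ G)
    (hpG : p ∈ G) (hx₁K : x₁ ∉ G.filter (fun y => y ∉ clF M (G.erase y)))
    (hx₂K : x₂ ∉ G.filter (fun y => y ∉ clF M (G.erase y))) (hpK : p ∉ G.filter (fun y => y ∉ clF M (G.erase y)))
    (hp : p ∈ clF M (insert x₁ (insert x₂ (G.filter (fun y => y ∉ clF M (G.erase y)))))) : p ∈ clF M {x₁, x₂} := by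
  set K := G.filter (fun y => y ∉ clF M (G.erase y)) with hKdef
  have hGg : G ⊆ gr M := (mem_flatsQ.1 hG).1
  have hY : ∀ y ∈ K, y ∈ G ∧ y ∉ clF M (G.erase y) := fun y hy => Finset.mem_filter.1 hy
  have h1 : M.eRk ((K ∪ {x₁, x₂} : Finset α) : Set α) = (K.card : ℕ∞) + M.eRk (({x₁, x₂} : Finset α) : Set α) := by
    apply eRk_union_coloops hGg K hY
    · intro e he
      rw [Finset.mem_insert, Finset.mem_singleton] at he
      rcases he with rfl | rfl
      · exact hx₁G
      · exact hx₂G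
    · rw [Finset.disjoint_insert_right, Finset.disjoint_singleton_right]
      exact ⟨hx₁K, hx₂K⟩
  have h2 : M.eRk ((K ∪ {x₁, x₂, p} : Finset α) : Set α) = (K.card : ℕ∞) + M.eRk (({x₁, x₂, p} : Finset α) : Set α) := by
    apply eRk_union_coloops hGg K hY
    · intro e he
      simp only [Finset.mem_insert, Finset.mem_singleton] at he
      rcases he with rfl | rfl | rfl
      · exact hx₁G
      · exact hx₂G
      · exact hpG
    · rw [Finset.disjoint_insert_right, Finset.disjoint_insert_right, Finset.disjoint_singleton_right]
      exact ⟨hx₁K, hx₂K, hpK⟩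
  rw [eRk_eq_rkN, eRk_eq_rkN] at h1 h2
  have h1' : rkN M (K ∪ {x₁, x₂}) = K.card + rkN M {x₁, x₂} := by exact_mod_cast h1
  have h2' : rkN M (K ∪ {x₁, x₂, p}) = K.card + rkN M {x₁, x₂, p} := by exact_mod_cast h2
  have hins : rkN M (insert p (insert x₁ (insert x₂ K))) ≤ rkN M (insert x₁ (insert x₂ K)) :=
    rkN_insert_le_of_mem_clF (Finset.insert_subset (hGg hx₁G) (Finset.insert_subset (hGg hx₂G) ((Finset.filter_subset _ _).trans hGg))) hp
  have he1 : insert x₁ (insert x₂ K) = K ∪ {x₁, x₂} := by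
    ext e; simp only [Finset.mem_insert, Finset.mem_union, Finset.mem_singleton]; tauto
  have he2 : insert p (insert x₁ (insert x₂ K)) = K ∪ {x₁, x₂, p} := by
    ext e; simp only [Finset.mem_insert, Finset.mem_union, Finset.mem_singleton]; tauto
  rw [he2, he1, h2', h1'] at hins
  have hsub : ({x₁, x₂} : Finset α) ⊆ {x₁, x₂, p} := by
    intro e he
    simp only [Finset.mem_insert, Finset.mem_singleton] at he ⊢
    tauto
  have hle : rkN M {x₁, x₂, p} ≤ rkN M {x₁, x₂} := by omega
  have hge : rkN M {x₁, x₂} ≤ rkN M {x₁, x₂, p} := rkN_mono hsub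
  have hpairg : ({x₁, x₂, p} : Finset α) ⊆ gr M := by
    intro e he
    simp only [Finset.mem_insert, Finset.mem_singleton] at he
    rcases he with rfl | rfl | rfl
    · exact hGg hx₁G
    · exact hGg hx₂G
    · exact hGg hpG
  have h := subset_closure_of_rkN_eq hpairg hsub (le_antisymm hge hle)
  rw [← Finset.mem_coe, coe_clF]
  exact h (by simp)

open scoped Classical in
/-- **Two fat candidates kill the preimages of `S`**: if `G ∖ S ⊆ cl(cand r) ∩ cl(cand r')` (`r ≠ r'` non-coloops) then
`G ∖ S ⊆ cl {x₁, x₂}` and `S ∖ xⱼ ∉ U_G` for `j = 1, 2` (`E ∖ (S ∖ xⱼ) ⊆ cl {x₁, x₂} ∪ (E ∖ G)` has rank `≤ 5`). -/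
theorem not_erase_mem_Uq_of_two_fat (hG : G ∈ flatsQ M (4 + 1)) (hd : (gr M \ G).card = 3)
    (hS : S ∈ shadowAt M (4 + 2) 4 (Uq M (4 + 2) 4) G) (hS6 : S.card = 6) (hT : (nonColoops M S).card = 3)
    {x₁ x₂ : α} (hx₁K : x₁ ∉ G.filter (fun y => y ∉ clF M (G.erase y)))
    (hx₂K : x₂ ∉ G.filter (fun y => y ∉ clF M (G.erase y)))
    (hcol : coloops M S = insert x₁ (insert x₂ (G.filter (fun y => y ∉ clF M (G.erase y))))) {r r' : α}
    (hr : r ∈ nonColoops M S) (hr' : r' ∈ nonColoops M S) (hne : r ≠ r')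
    (hf : G \ S ⊆ clF M (insert r (coloops M S))) (hf' : G \ S ⊆ clF M (insert r' (coloops M S))) {x : α}
    (hx : x = x₁ ∨ x = x₂) : S.erase x ∉ Uq M (4 + 2) 4 := by
  set K := G.filter (fun y => y ∉ clF M (G.erase y)) with hKdef
  have hGg : G ⊆ gr M := (mem_flatsQ.1 hG).1
  have hSG : S ⊆ G := subset_of_mem_shadowAt hS
  have hx₁c : x₁ ∈ coloops M S := by rw [hcol]; exact Finset.mem_insert_self _ _
  have hx₂c : x₂ ∈ coloops M S := by rw [hcol]; exact Finset.mem_insert_of_mem (Finset.mem_insert_self _ _)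
  have hx₁G : x₁ ∈ G := hSG (coloops_subset_self S hx₁c)
  have hx₂G : x₂ ∈ G := hSG (coloops_subset_self S hx₂c)
  -- `G ∖ S ⊆ cl {x₁, x₂}`
  obtain ⟨u', hu'T, hu'r, hu'r', hSu'⟩ := exists_third_nonColoop hT hr hr' hne
  have hI : M.Indep ((S.erase u' : Finset α) : Set α) := indep_erase_of_mem_nonColoops hG hS hS6 hu'T
  have h1 : insert r (coloops M S) ⊆ S.erase u' := insert_coloops_subset_erase hr hu'T (Ne.symm hu'r)
  have h2 : insert r' (coloops M S) ⊆ S.erase u' := insert_coloops_subset_erase hr' hu'T (Ne.symm hu'r')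
  have hint : insert r (coloops M S) ∩ insert r' (coloops M S) = coloops M S := by
    ext e
    simp only [Finset.mem_inter, Finset.mem_insert]
    constructor
    · rintro ⟨h | h, h' | h'⟩
      · exact absurd (h.symm.trans h') hne
      · exact h'
      · exact h
      · exact h
    · intro h; exact ⟨Or.inr h, Or.inr h⟩
  have hPcl : G \ S ⊆ clF M {x₁, x₂} := by
    intro p hp
    have hpG : p ∈ G := (Finset.mem_sdiff.1 hp).1
    have hpS : p ∉ S := (Finset.mem_sdiff.1 hp).2
    have hpK : p ∉ K := fun h => hpS (coloops_subset_self S (coloopsG_subset_coloops hS h))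
    have hpcl : p ∈ clF M (coloops M S) := by
      rw [← hint]; exact mem_clF_inter_of_indep hI h1 h2 (hf hp) (hf' hp)
    rw [hcol] at hpcl
    exact mem_clF_pair_of_mem_clF_coloops hG hx₁G hx₂G hpG hx₁K hx₂K hpK hpcl
  -- the rank of `E ∖ (S ∖ x)`
  have hxS : x ∈ S := by rcases hx with rfl | rfl <;> exact coloops_subset_self S (by assumption)
  have hxcl : x ∈ clF M {x₁, x₂} := by
    have hpair : ({x₁, x₂} : Finset α) ⊆ gr M := by
      intro e he
      rw [Finset.mem_insert, Finset.mem_singleton] at he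
      rcases he with rfl | rfl
      · exact hGg hx₁G
      · exact hGg hx₂G
    apply subset_clF_of_subset_gr hpair
    rcases hx with rfl | rfl
    · exact Finset.mem_insert_self _ _
    · exact Finset.mem_insert_of_mem (Finset.mem_singleton_self _)
  intro hmem
  have hr6 : rkN M (gr M \ S.erase x) = 6 := by
    have h := (mem_Uq.1 hmem).2.2
    rw [eRk_eq_rkN] at h
    exact_mod_cast h
  have hsub : gr M \ S.erase x ⊆ clF M {x₁, x₂} ∪ (gr M \ G) := by
    intro e he
    rw [Finset.mem_sdiff, Finset.mem_erase, not_and_or, not_not] at he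
    rw [Finset.mem_union, Finset.mem_sdiff]
    by_cases heG : e ∈ G
    · left
      rcases he.2 with rfl | heS
      · exact hxcl
      · exact hPcl (Finset.mem_sdiff.2 ⟨heG, heS⟩)
    · right
      exact ⟨he.1, heG⟩
  have h1 := rkN_mono (M := M) hsub
  have h2 := rkN_inter_add_rkN_union_le (M := M) (clF M {x₁, x₂}) (gr M \ G)
  have h3 : rkN M (gr M \ G) ≤ 3 := hd ▸ rkN_le_card _
  have h4 : rkN M (clF M {x₁, x₂}) ≤ 2 := by
    rw [rkN_clF]
    exact (rkN_le_card _).trans Finset.card_le_two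
  omega

open scoped Classical in
/-- `L₁(S) ≤ r₁' + r₂'`: the only possible layer-1 preimages of `S` are `S ∖ x₁`, `S ∖ x₂` (the `K`-deletion is layer-0, the
non-coloop deletions have rank `5`). -/
theorem L1_le_req_erase_two (hG : G ∈ flatsQ M (4 + 1)) (hd : (gr M \ G).card = 3)
    (hS : S ∈ shadowAt M (4 + 2) 4 (Uq M (4 + 2) 4) G) {x₁ x₂ : α} (hne : x₁ ≠ x₂)
    (hx₁K : x₁ ∉ G.filter (fun y => y ∉ clF M (G.erase y))) (hx₂K : x₂ ∉ G.filter (fun y => y ∉ clF M (G.erase y)))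
    (hcol : coloops M S = insert x₁ (insert x₂ (G.filter (fun y => y ∉ clF M (G.erase y))))) :
    L1 M 4 G S ≤ (if S.erase x₁ ∈ membersIn M (Uq M (4 + 2) 4) G then req M 4 (S.erase x₁) else 0) +
      (if S.erase x₂ ∈ membersIn M (Uq M (4 + 2) 4) G then req M 4 (S.erase x₂) else 0) := by
  set K := G.filter (fun y => y ∉ clF M (G.erase y)) with hKdef
  refine (L1_le_sum_erase hG hd hS).trans ?_
  have hx₁c : x₁ ∈ coloops M S := by rw [hcol]; exact Finset.mem_insert_self _ _
  have hx₂c : x₂ ∈ coloops M S := by rw [hcol]; exact Finset.mem_insert_of_mem (Finset.mem_insert_self _ _)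
  have hsub : ({x₁, x₂} : Finset α) ⊆ S \ K := by
    intro e he
    rw [Finset.mem_insert, Finset.mem_singleton] at he
    rcases he with rfl | rfl
    · exact Finset.mem_sdiff.2 ⟨coloops_subset_self S hx₁c, hx₁K⟩
    · exact Finset.mem_sdiff.2 ⟨coloops_subset_self S hx₂c, hx₂K⟩
  -- the terms of the non-coloops vanish
  have hzero : ∀ t ∈ S \ K, t ∉ ({x₁, x₂} : Finset α) →
      (if S.erase t ∈ membersIn M (Uq M (4 + 2) 4) G then req M 4 (S.erase t) else 0) = 0 := by
    intro t ht hnot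
    rw [if_neg]
    intro hm
    have htc : t ∉ coloops M S := by
      rw [hcol, Finset.mem_insert, Finset.mem_insert]
      rintro (h | h | h)
      · exact hnot (by rw [h]; exact Finset.mem_insert_self _ _)
      · exact hnot (by rw [h]; exact Finset.mem_insert_of_mem (Finset.mem_singleton_self _))
      · exact (Finset.mem_sdiff.1 ht).2 h
    have hr5 : rkN M (S.erase t) = 5 := by
      rw [rkN_erase_eq_of_nonColoop (Finset.mem_sdiff.1 ht).1 htc, rkN_eq_of_mem_shadowAt hS]
    have hr4 : rkN M (S.erase t) = 4 := by
      have h := (mem_Uq.1 (mem_membersIn.1 hm).1).2.1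
      rw [eRk_eq_rkN] at h
      exact_mod_cast h
    omega
  rw [← Finset.sum_subset hsub hzero, Finset.sum_pair hne]

open scoped Classical in
/-- **The layer-1 request at a covering set `S ∖ v`** (`v ∈ T = {v, z₁, z₂}`): the deletions of the independent five-set `S ∖ v`
outside `K` are `(S ∖ v) ∖ x₁`, `(S ∖ v) ∖ x₂` (requests `≤ req(S ∖ xⱼ)`) and the two candidates `insert z₂ (coloops S)`,
`insert z₁ (coloops S)`. -/
theorem L1_erase_le_four (hG : G ∈ flatsQ M (4 + 1)) (hd : (gr M \ G).card = 3)
    (hS : S ∈ shadowAt M (4 + 2) 4 (Uq M (4 + 2) 4) G) {x₁ x₂ : α} (hne : x₁ ≠ x₂)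
    (hx₁K : x₁ ∉ G.filter (fun y => y ∉ clF M (G.erase y))) (hx₂K : x₂ ∉ G.filter (fun y => y ∉ clF M (G.erase y)))
    (hcol : coloops M S = insert x₁ (insert x₂ (G.filter (fun y => y ∉ clF M (G.erase y))))) {v z₁ z₂ : α}
    (hT : nonColoops M S = {v, z₁, z₂}) (hv1 : v ≠ z₁) (hv2 : v ≠ z₂) (h12 : z₁ ≠ z₂)
    (hSv : S.erase v ∈ shadowAt M (4 + 2) 4 (Uq M (4 + 2) 4) G) {r₁ r₂ : ℚ}
    (hr₁ : insert z₁ (coloops M S) ∈ membersIn M (Uq M (4 + 2) 4) G → req M 4 (insert z₁ (coloops M S)) ≤ r₁)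
    (hr₂ : insert z₂ (coloops M S) ∈ membersIn M (Uq M (4 + 2) 4) G → req M 4 (insert z₂ (coloops M S)) ≤ r₂)
    (hr₁0 : 0 ≤ r₁) (hr₂0 : 0 ≤ r₂) :
    L1 M 4 G (S.erase v) ≤ req M 4 (S.erase x₁) + req M 4 (S.erase x₂) + r₁ + r₂ := by
  set K := G.filter (fun y => y ∉ clF M (G.erase y)) with hKdef
  have hGg : G ⊆ gr M := (mem_flatsQ.1 hG).1
  have hSG : S ⊆ G := subset_of_mem_shadowAt hS
  have hv : v ∈ nonColoops M S := by rw [hT]; exact Finset.mem_insert_self _ _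
  have hx₁c : x₁ ∈ coloops M S := by rw [hcol]; exact Finset.mem_insert_self _ _
  have hx₂c : x₂ ∈ coloops M S := by rw [hcol]; exact Finset.mem_insert_of_mem (Finset.mem_insert_self _ _)
  have hx₁S : x₁ ∈ S := coloops_subset_self S hx₁c
  have hx₂S : x₂ ∈ S := coloops_subset_self S hx₂c
  have hx₁v : x₁ ≠ v := fun h => (mem_nonColoops.1 hv).2 (h ▸ hx₁c)
  have hx₂v : x₂ ≠ v := fun h => (mem_nonColoops.1 hv).2 (h ▸ hx₂c)
  have hx₁e : x₁ ∈ gr M \ clF M (S.erase x₁) := Finset.mem_sdiff.2 ⟨hGg (hSG hx₁S), (mem_coloops.1 hx₁c).2⟩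
  have hx₂e : x₂ ∈ gr M \ clF M (S.erase x₂) := Finset.mem_sdiff.2 ⟨hGg (hSG hx₂S), (mem_coloops.1 hx₂c).2⟩
  refine (L1_le_sum_erase hG hd hSv).trans ?_
  -- `(S ∖ v) ∖ K = {x₁, x₂, z₁, z₂}`
  have hset : (S.erase v) \ K = {x₁, x₂, z₁, z₂} := by
    ext e
    simp only [Finset.mem_sdiff, Finset.mem_erase, Finset.mem_insert, Finset.mem_singleton]
    constructor
    · rintro ⟨⟨hev, heS⟩, heK⟩
      rcases mem_coloops_or_mem_nonColoops (M := M) heS with hc | hn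
      · rw [hcol, Finset.mem_insert, Finset.mem_insert] at hc
        rcases hc with h | h | h
        · exact Or.inl h
        · exact Or.inr (Or.inl h)
        · exact absurd h heK
      · rw [hT, Finset.mem_insert, Finset.mem_insert, Finset.mem_singleton] at hn
        rcases hn with h | h | h
        · exact absurd h hev
        · exact Or.inr (Or.inr (Or.inl h))
        · exact Or.inr (Or.inr (Or.inr h))
    · have hz₁ : z₁ ∈ nonColoops M S := by rw [hT]; exact Finset.mem_insert_of_mem (Finset.mem_insert_self _ _)
      have hz₂ : z₂ ∈ nonColoops M S := by
        rw [hT]; exact Finset.mem_insert_of_mem (Finset.mem_insert_of_mem (Finset.mem_singleton_self _))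
      rintro (h | h | h | h) <;> rw [h]
      · exact ⟨⟨hx₁v, hx₁S⟩, hx₁K⟩
      · exact ⟨⟨hx₂v, hx₂S⟩, hx₂K⟩
      · exact ⟨⟨Ne.symm hv1, (mem_nonColoops.1 hz₁).1⟩, fun h' => (mem_nonColoops.1 hz₁).2
          (by rw [hcol]; exact Finset.mem_insert_of_mem (Finset.mem_insert_of_mem h'))⟩
      · exact ⟨⟨Ne.symm hv2, (mem_nonColoops.1 hz₂).1⟩, fun h' => (mem_nonColoops.1 hz₂).2
          (by rw [hcol]; exact Finset.mem_insert_of_mem (Finset.mem_insert_of_mem h'))⟩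
  rw [hset]
  have hnn : ∀ t, 0 ≤ (if (S.erase v).erase t ∈ membersIn M (Uq M (4 + 2) 4) G then req M 4 ((S.erase v).erase t) else 0) := by
    intro t; split_ifs
    · exact req_nonneg 4 _
    · exact le_refl _
  have hz₁ : z₁ ∉ ({z₂} : Finset α) := by rw [Finset.mem_singleton]; exact h12
  have hx₂' : x₂ ∉ ({z₁, z₂} : Finset α) := by
    rw [Finset.mem_insert, Finset.mem_singleton]
    rintro (h | h)
    · exact (mem_nonColoops.1 (by rw [hT]; exact Finset.mem_insert_of_mem (Finset.mem_insert_self _ _) : z₁ ∈ nonColoops M S)).2 (h ▸ hx₂c)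
    · exact (mem_nonColoops.1 (by rw [hT]; exact Finset.mem_insert_of_mem (Finset.mem_insert_of_mem (Finset.mem_singleton_self _)) : z₂ ∈ nonColoops M S)).2 (h ▸ hx₂c)
  have hx₁' : x₁ ∉ ({x₂, z₁, z₂} : Finset α) := by
    rw [Finset.mem_insert]
    rintro (h | h)
    · exact hne h
    · exact hx₂' (by
        have h' : x₂ ∈ ({z₁, z₂} : Finset α) := by
          rw [Finset.mem_insert, Finset.mem_singleton] at h ⊢
          rcases h with h | h
          · left; exact (mem_nonColoops.1 (by rw [hT]; exact Finset.mem_insert_of_mem (Finset.mem_insert_self _ _) : z₁ ∈ nonColoops M S)).2 (h ▸ hx₁c) |>.elim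
          · right; exact (mem_nonColoops.1 (by rw [hT]; exact Finset.mem_insert_of_mem (Finset.mem_insert_of_mem (Finset.mem_singleton_self _)) : z₂ ∈ nonColoops M S)).2 (h ▸ hx₁c) |>.elim
        exact h')
  rw [Finset.sum_insert hx₁', Finset.sum_insert hx₂', Finset.sum_insert hz₁, Finset.sum_singleton]
  have h1 : (if (S.erase v).erase x₁ ∈ membersIn M (Uq M (4 + 2) 4) G then req M 4 ((S.erase v).erase x₁) else 0) ≤
      req M 4 (S.erase x₁) := by
    split_ifs with h
    · exact req_le_req_of_subset (Finset.erase_subset_erase x₁ (Finset.erase_subset v S)) hx₁e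
    · exact req_nonneg 4 _
  have h2 : (if (S.erase v).erase x₂ ∈ membersIn M (Uq M (4 + 2) 4) G then req M 4 ((S.erase v).erase x₂) else 0) ≤
      req M 4 (S.erase x₂) := by
    split_ifs with h
    · exact req_le_req_of_subset (Finset.erase_subset_erase x₂ (Finset.erase_subset v S)) hx₂e
    · exact req_nonneg 4 _
  have h3 : (if (S.erase v).erase z₁ ∈ membersIn M (Uq M (4 + 2) 4) G then req M 4 ((S.erase v).erase z₁) else 0) ≤ r₂ := by
    rw [erase_erase_eq_insert hT hv1 hv2 h12]
    split_ifs with h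
    · exact hr₂ h
    · exact hr₂0
  have h4 : (if (S.erase v).erase z₂ ∈ membersIn M (Uq M (4 + 2) 4) G then req M 4 ((S.erase v).erase z₂) else 0) ≤ r₁ := by
    have hT' : nonColoops M S = {v, z₂, z₁} := by rw [hT, Finset.pair_comm z₁ z₂]
    rw [erase_erase_eq_insert hT' hv2 hv1 h12.symm]
    split_ifs with h
    · exact hr₁ h
    · exact hr₁0
  linarith

end ThreeOneA

end PercRepro.Shadow
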